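import Summits.CriticalPhenomena.PercolationContinuityZ3.Theses.PercNecklaceBackbone
import Summits.CriticalPhenomena.PercolationContinuityZ3.Theorems.PercNearOneGluingNoHeavyLowerTailCSHTheoremOne
import Summits.CriticalPhenomena.PercolationContinuityZ3.Theorems.PercNecklaceBackboneNoBackboneBirthGlue
import HarnessLib

/-!
# `PercNecklaceBackbone.NoBackbone` (stmt-CriticalPhenomena-5268) — SETTLED after continuity

Item `stmt-CriticalPhenomena-5268` of route `CriticalPhenomena/PercNecklaceBackbone` (crux).

The tree already derives the item from the sub-problem statement (`noBackbone_of_percolationContinuityZ3` in `PercNecklaceBackboneNoBackboneBirthGlue`); composing with the tree theorem `θ(p_c(ℤ³)) = 0` (`CSH.percolationContinuityZ3_holds`, p205010) settles it.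

builds on p205010 (kernel theorem, internal audit signed; external expert review pending) — USED (`CSH.percolationContinuityZ3_holds`).  RSW3 lane, lead gen 28 (prover-prim-rsw3-lead-g28-0):
'after continuity — the ledger harvest'.
References: G. Kozma, N. Nitzan (2024), Thm. 6 / Conj. 3 [KozmaNitzan2024]; G. Grimmett, *Percolation* (1999), §8 [GrimmettPercolation1999].
-/

noncomputable section

namespace Summit.CriticalPhenomena.PercolationContinuityZ3.Theorems

namespace PercNecklaceBackboneNoBackbone

open MeasureTheory Literature.Probability.Percolation Literature.Probability.LatticeModels

/-- **`PercNecklaceBackbone.NoBackbone` (stmt-CriticalPhenomena-5268), settled.**  The tree's implication from the sub-problem statement, applied to `CSH.percolationContinuityZ3_holds` (p205010).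
[cite: KozmaNitzan2024, Thm. 6 with Conj. 3 (p. 15)] -/
theorem noBackbone_proof : Summit.CriticalPhenomena.PercolationContinuityZ3.Theses.PercNecklaceBackbone.NoBackbone := by
  exact Summit.CriticalPhenomena.PercolationContinuityZ3.Theorems.NoBackboneBirth.noBackbone_of_percolationContinuityZ3 CSH.percolationContinuityZ3_holds

end PercNecklaceBackboneNoBackbone

end Summit.CriticalPhenomena.PercolationContinuityZ3.Theorems

end
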